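import Summits.ResolutionOfSingularities.ResolutionOfSingularities.Theorems.RadicialJungCleanModelsLocalMonomializationOfEmbRes
import Summits.ResolutionOfSingularities.ResolutionOfSingularities.Theorems.RadicialJungCleanModelsCleanLU3ArcPackage
import Literature.AlgebraicGeometry.Resolution.ResolutionLU
import HarnessLib

/-!
# Weak embedded local uniformization in dimension `≤ 3`, from ARBITRARY finitely generated models along ANY valuation (mod F-02 + F-32)

Route `RadicialJung`, crux `CleanModels` (stmt-ResolutionOfSingularities-15917), registered skeleton `Cruxes/CleanModels/Lines/Sketch.lean`
rev 35 (sha16 de44649d8f729c3b), stub 7 `stub_cleanModelsDimGEFour`.  Explicit-unit seat `decomp-res-hand-2` g4 (structural hand).  OURS;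
structural bookkeeping, counted 0; nothing here proves resolution of singularities in characteristic `p`.

`weakEmbeddedLU_dimLEThree_of_cossartPiltant2019` — **Novacoski–Spivakovsky's «weak embedded local uniformization» (arXiv:1204.4751,
Def. 2.21) for every finitely generated model `A ⊆ O` of a function field `K/k` of dimension `≤ 3`, NOT assumed regular anywhere, along
EVERY valuation ring `O` (any rank, any residue dimension), monomializing any finite `Z ⊆ A`**: some finitely generated `A ⊆ A' ⊆ O` is regular
at the centre of `O` and every non-zero `z ∈ Z` is a unit times a monomial in a regular system of parameters there.  Proof: local
uniformization along `O` (F-02, Cossart–Piltant 2019 Thm. 1.1 through ✓ `CossartPiltant2019.lu3`), then hand-2 g3's ✓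
`localMonomialization_of_embeddedResolution` (F-32 in its CJS Cor. 1.5 shape `hEmb`, `N = 2`) at the now regular centre, whose dimension is
`≤ 3` (`ht (𝔪_O ∩ A₃) ≤ dim A₃ = dim A`); a centre of dimension `0` (the generic point) is the trivial case `Z ⊆ units`.

Census role (hand-2 g4 memo `Cruxes/CleanModels/Lines/Sketch-memo-hand2-g4-stubs-5-7.md`): this is the PRINTED lower-dimensional input of the
rank-one reduction of stub 7's local input `hMono_4` along Novacoski–Spivakovsky 2012 Thm. 1.2 / §3.2 — their induction on the rank applies
weak embedded LU to `R_𝔭` (regular for free when `R` is) and to the HOMOMORPHIC IMAGE `R/𝔭` (singular in general, dimension `< 4`), which is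
what this theorem supplies in dimension `≤ 3`. [cite: NovacoskiSpivakovsky2014, Thm. 1.2, Def. 2.21, §3.2]
-/

noncomputable section

set_option linter.dupNamespace false -- mandated namespace of this single-conjunct summit

open IsLocalRing AlgebraicGeometry CategoryTheory
open Literature.AlgebraicGeometry.Resolution Literature.AlgebraicGeometry.Motives

namespace Summit.ResolutionOfSingularities.ResolutionOfSingularities.Theorems.RadicialJung.CleanModels

/-- The Krull dimension of a local domain of dimension `≤ 3` whose maximal ideal is non-zero is `n + 1` for some `n ≤ 2`
(the dimension is a natural number; it is not `0`, for a zero-dimensional domain is a field). [folklore] -/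
theorem exists_ringKrullDim_eq_succ_of_le_three {S : Type} [CommRing S] [IsDomain S] [IsLocalRing S]
    (hle : ringKrullDim S ≤ 3) (hbot : maximalIdeal S ≠ ⊥) :
    ∃ n : ℕ, n ≤ 2 ∧ ringKrullDim S = (n + 1 : ℕ) := by
  have h0 : (0 : WithBot ℕ∞) ≤ ringKrullDim S := ringKrullDim_nonneg_of_nontrivial
  obtain ⟨d, hd⟩ : ∃ d : ℕ, ringKrullDim S = (d : WithBot ℕ∞) := by
    generalize ringKrullDim S = x at h0 hle
    induction x using WithBot.recBotCoe with
    | bot => exact absurd h0 (by simp)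
    | coe y =>
      induction y using ENat.recTopCoe with
      | top =>
        exfalso
        have h' : ((⊤ : ℕ∞) : WithBot ℕ∞) ≤ (((3 : ℕ) : ℕ∞) : WithBot ℕ∞) := hle
        exact ENat.coe_ne_top 3 (top_le_iff.mp (WithBot.coe_le_coe.mp h'))
      | coe d => exact ⟨d, rfl⟩
  have hd3 : d ≤ 3 := by
    have h := hle
    rw [hd] at h
    exact_mod_cast h
  have hd0 : d ≠ 0 := by
    rintro rfl
    haveI : Ring.KrullDimLE 0 S := Ring.krullDimLE_iff.mpr (hd.le.trans (by simp))
    exact hbot ((IsLocalRing.isField_iff_maximalIdeal_eq).mp (Ring.KrullDimLE.isField_of_isDomain (R := S)))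
  obtain ⟨n, rfl⟩ := Nat.exists_eq_succ_of_ne_zero hd0
  exact ⟨n, by omega, hd⟩

/-- **Weak embedded local uniformization in dimension `≤ 3` (Novacoski–Spivakovsky 2012, Def. 2.21), from ARBITRARY finitely generated models
along ANY valuation, modulo F-02 and F-32.**  For a field `K ⊇ k`, a valuation ring `O` of `K`, a finitely generated `k`-subalgebra `A ⊆ O`
with `Frac A = K` and `dim A ≤ 3` (no regularity assumed), and a finite `Z ⊆ A`: there is a finitely generated `A ⊆ A' ⊆ O` whose local ring
at the centre of `O` is regular, with a regular system of parameters `a` in which every non-zero `z ∈ Z` is a unit times a monomial.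
Local uniformization (Cossart–Piltant 2019 Thm. 1.1, ✓ `CossartPiltant2019.lu3`) followed by local monomialization at the regular centre
(CJS 2020 Cor. 1.5 shape `hEmb`, ✓ `localMonomialization_of_embeddedResolution`).  The PRINTED lower-dimensional input of the rank-one
reduction of `hMono_4` along Novacoski–Spivakovsky's Thm. 1.2 (applied to the homomorphic images `R/𝔭`, of dimension `≤ 3`).
[cite: CossartPiltant2019, Thm. 1.1] [cite: CossartJannsenSaito2020, Cor. 1.5] [cite: NovacoskiSpivakovsky2014, Thm. 1.2 and Def. 2.21] -/
theorem weakEmbeddedLU_dimLEThree_of_cossartPiltant2019 (hCP : CossartPiltant2019.{0})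
    (hEmb : ∀ (Z : Scheme.{0}) [IsIntegral Z] [IsNoetherian Z], Scheme.IsRegular Z →
      Scheme.IsExcellent Z → ∀ (X : Set Z), IsClosed X → X ≠ Set.univ → topologicalKrullDim X ≤ 2 →
        ∃ (Z' : Scheme.{0}) (π : Z' ⟶ Z), IsProper π ∧ Function.Surjective π.base ∧
          (∃ U : Z.Opens, (U : Set Z) = Xᶜ ∧ IsIso (π ∣_ U)) ∧
          IsStrictNormalCrossingsDivisor Z' (π.base ⁻¹' X)) :
    ∀ (k : Type) [Field k] (K : Type) [Field K] [Algebra k K]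
    (O : ValuationSubring K) (A : Subalgebra k K), A.toSubring ≤ O.toSubring → A.FG → IsFractionRing A K →
    ringKrullDim A ≤ 3 →
    ∀ Z : Finset K, (∀ z ∈ Z, z ∈ A) →
    ∃ (A' : Subalgebra k K), A'.toSubring ≤ O.toSubring ∧ A ≤ A' ∧ A'.FG ∧
    ∃ (_ : IsRegularLocalRing (locAtCentre A'.toSubring O)) (e : ℕ) (a : Fin e → ↥(locAtCentre A'.toSubring O)),
      Ideal.span (Set.range a) = IsLocalRing.maximalIdeal ↥(locAtCentre A'.toSubring O) ∧
      ringKrullDim ↥(locAtCentre A'.toSubring O) = (e : WithBot ℕ∞) ∧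
      ∀ z ∈ Z, z ≠ 0 → ∃ (v : ↥(locAtCentre A'.toSubring O)) (μ : Fin e → ℕ), IsUnit v ∧
        z = (v : K) * ∏ i, ((a i : ↥(locAtCentre A'.toSubring O)) : K) ^ (μ i) := by
  intro k _ K _ _ O A hAO hAfg hfrac hdimA Z hZ
  classical
  haveI := hfrac
  -- (1) local uniformization along `O` (F-02)
  obtain ⟨A₃, hA₃O, hAA₃, hA₃fg, hreg⟩ := hCP.lu3 k K O A hAO hAfg hfrac hdimA
  have hreg' : IsRegularLocalRing (locAtCentre A₃.toSubring O) := (isRegularLocalRing_locAtCentre_iff hA₃O).mpr hreg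
  haveI := hreg'
  -- (2) the dimension of the regular local ring at the centre is `≤ dim A₃ = dim A ≤ 3`
  have hdimS_le : ringKrullDim (locAtCentre A₃.toSubring O) ≤ 3 := by
    haveI := isLocalization_locAtCentre (B := A₃.toSubring) (O := O) hA₃O
    rw [IsLocalization.AtPrime.ringKrullDim_eq_height (subringCentre A₃.toSubring O hA₃O) (locAtCentre A₃.toSubring O)]
    have h1 : ((subringCentre A₃.toSubring O hA₃O).height : WithBot ℕ∞) ≤ ringKrullDim A₃.toSubring :=
      Ideal.height_le_ringKrullDim_of_isPrime
    have h2 : ringKrullDim A₃ ≤ 3 := by rw [ringKrullDim_eq_of_fg_of_le hAfg hA₃fg hAA₃]; exact hdimA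
    exact h1.trans h2
  by_cases hbot : maximalIdeal (locAtCentre A₃.toSubring O) = ⊥
  · -- (3a) the centre is the generic point: the local ring is a field and every non-zero `z ∈ Z` is a unit there
    have hfield : IsField (locAtCentre A₃.toSubring O) := (IsLocalRing.isField_iff_maximalIdeal_eq).mpr hbot
    refine ⟨A₃, hA₃O, hAA₃, hA₃fg, hreg', 0, Fin.elim0, ?_, ?_, ?_⟩
    · rw [hbot, Set.range_eq_empty, Ideal.span_empty]
    · simpa using ringKrullDim_eq_zero_of_isField hfield
    · intro z hz hz0
      have hzS : z ∈ locAtCentre A₃.toSubring O := le_locAtCentre A₃.toSubring O (hAA₃ (hZ z hz))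
      have hunit : IsUnit (⟨z, hzS⟩ : locAtCentre A₃.toSubring O) := by
        by_contra hnu
        have hmem : (⟨z, hzS⟩ : locAtCentre A₃.toSubring O) ∈ maximalIdeal (locAtCentre A₃.toSubring O) :=
          (IsLocalRing.mem_maximalIdeal _).mpr hnu
        rw [hbot, Ideal.mem_bot] at hmem
        exact hz0 (congrArg Subtype.val hmem)
      exact ⟨⟨z, hzS⟩, Fin.elim0, hunit, by simp⟩
  · -- (3b) positive-dimensional centre: monomialize `Z` at the regular centre by embedded resolution (F-32)
    obtain ⟨n, hn2, hdimS⟩ := exists_ringKrullDim_eq_succ_of_le_three hdimS_le hbot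
    obtain ⟨A', hA'O, hA₃A', hA'fg, hregA', e, a, ha, hdim', hmono⟩ :=
      localMonomialization_of_embeddedResolution 2 hEmb hn2 k K O A₃ hA₃O hA₃fg hreg' hdimS Z
        (fun z hz => hAA₃ (hZ z hz))
    exact ⟨A', hA'O, hAA₃.trans hA₃A', hA'fg, hregA', e, a, ha, hdim', hmono⟩

end Summit.ResolutionOfSingularities.ResolutionOfSingularities.Theorems.RadicialJung.CleanModels

end
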